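import Mathlib
import Literature.MathematicalPhysics.QuantumFieldTheory.Balaban1983to89.B7
import Literature.MathematicalPhysics.QuantumFieldTheory.Balaban1983to89.B8

/-!
# `Balaban1983to89.B10` — T. Bałaban, *Ultraviolet stability of three-dimensional lattice pure gauge field theories*,
Commun. Math. Phys. **102**, 255–275 (1985), doi:10.1007/bf01229380.  (Cell numbering: B10; = ref. [16] of
[Balaban1987RG1], cited by [Balaban1988Convergent] p. 264 and [Balaban1989LargeFieldII] pp. 355–356 as the model of
the ultraviolet-stability bounds.)  PDF held: `paper:balaban1985-cmp102-uv-stability-3d` (journal page = PDF page + 254).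

CITATION HEADER (lean-in-tree rule 2026-08-18).  This module is a TYPED SKELETON (statement level) of the published
paper [Balaban1985UV3] (cell paper B10).  WHAT IS REPRODUCED: Theorem 1 (p. 257) with the bounds (5) (p. 256) and the
uniformity sentence "O(1) independent of ε, k, g_k in a bounded set", Theorem 2 (p. 272), the implication leaf
"(41), (47) ⇒ (5)" of Sect. D (pp. 272–275), each as a `def … : Prop` whose docstring carries the VERBATIM printed
statement (journal page [PDF page]); plus one kernel-checked piece of bookkeeping (`partition_upper`, the upper half
of remark (6)).  NOTHING of the series is asserted; every `…Printed` Prop is consumed downstream only as a hypothesis.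
d = 3 THROUGHOUT — this is the superrenormalizable sibling of the d = 4 series under adjudication by the audit cell
`pub-balaban`; every point where d = 4 differs is flagged (cell DIVERGENCE.md D-r2.1; GAPS.md G-r2.5a / G-adv3-1:
[Balaban1988Convergent] p. 264 opens its Sect. 3 with *"Almost all operations and bounds were studied in the previous
papers [16, I], so we concentrate only on new issues"* — [16] = this paper — whereas its Corollary 3 derivation of the
d = 4 bound (2.50) on the same page cites *"Sect. 3 [6], e.g., see (3.42)"* = [(Higgs)₂,₃ II] Sect. 3.C, NOT this
paper; the v1 header's "[16]" in that sentence was a misreading, cell DIVERGENCE.md D-adv3-1).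
AUTHOR'S OWN FLAG (p. 257 [3]): *"Let us mention finally that the proof is very
sketchy and we do not discuss many technical details. It is so because we intend to improve several aspects of the
proof, and here we develop only main ideas."*; *"In the proof of the above theorem we concentrate mainly on the proof
of the upper bound, we make only few remarks about the easier lower bound."*

d = 3 vs d = 4: `g₀² = g² ε^{4−d} = g² ε`, `g_k = g (L^k ε)^{1/2}` — the small-coupling hypothesis is automatic
(`…Balaban1983to89.B12.interval_automatic_d3`); no β-functions, no 𝐑 operation; O(1) in (5) "independent of ε, k, g_k
in a bounded set".

Cross-reference, not restated: `Literature.MathematicalPhysics.QuantumFieldTheory.ConstructiveQFTBalabanRG.BalabanUVStability3`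
is a SCHEMATIC CONCRETE transcription of Theorem 1 at the LAST step only (two-sided `e^{∓c|Λ|}` bounds for the n-fold
block transform of the Wilson density in a simplified free-boundary axial-gauge scheme, flagged there); the present
module types the printed statement itself — the bounds (5) at EVERY step k including the main term
`−(1/g_k²) A^η(U_k(U))` and the small-field characteristic function — over an abstract carrier, for use as the d = 3
comparandum of the cell's d = 4 records.  Why a local carrier and not the shared `Setup` vocabulary: `Setup` fixes the
d = 4 conventions of [Balaban1987RG1] ((0.17)–(0.20), β-functions); the d = 3 densities (1)–(2) with `g_k = g(L^kε)^{1/2}`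
are a different recursion, and the carrier below only NAMES the printed functionals.  Staged byte-identically in the
cell package `run/shared/lean/pub/pub-balaban/lean/BalabanYm4/Literature/…/B10.lean` (legacy copy `BalabanYm4/B10.lean`
there, namespace `BalabanYm4.B10`, same declarations).  Unit `b2b-balaban-r2` (reader group B+C); companion prose
`HOME/b2b-balaban-r2/B10.md`.

PHASE 2 (sub-cell `b2b-balaban-b10`, 2026-08-18; whole paper re-read from the page renders, pp. 255–275).  The section
`## Phase 2` below ADDS to unit r2's declarations (none of which is changed): (a) the parameters of the construction
(p. 256: `gRun` = g_k, `sitesRun` = |T₁^{(k)}|; (7) `pFun` = p(g)) with kernel-checked real analysis of the small-field window ((11):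
`smallFactor_le_pow`; Sect. D first line: `gsq_psq_le`; the tangent-line lemma `rpow_mul_exp_neg_le` behind both);
(b) the displayed load-bearing statements typed as leaves over a second local carrier `TowerRun` (= `RunData` + the
large-field history sum of (41)): (25) `Bound25Printed`, (36)–(37) `FirstStep36_37Printed`, (41) `Ineq41`, (47) `Ineq47`,
Sect. C `SectCStepPrinted`, (46) `Bound46Printed`, (67)–(71) + ref. [9] Sect. 3.C `LargeFieldControlPrinted`;
(c) kernel-proved paper-internal bookkeeping: Thm 2 ⇐ (1) + Sect. A + Sect. C by induction on k (`thm2_of_sections`),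
Sect. D "(41), (47) ⇒ (5)" (`upper5_of_41`, `lower5_of_47`, `bounds5At_of_ineqs`, `thm1Compact_of_thm2`), (62) +
(64)–(65) WITH THE `d(𝔤) log g_k` TERM OF (62) EXPLICIT (`Estep62_abs_le`, `Ek_abs_le`, `Ecst_abs_le`), the d = 3 power
counting of (45)–(46) against d = 4 (`powerCounting_d3` / `powerCounting_d4` — the one bound of this paper that [Balaban1988Convergent] §3 cannot
import "from [16, I]", cell GAPS G-r2.5a(ii) / G-adv3-1), the
remainder sum of (41) (`remainderSum_le`), the (70)–(71) arithmetic, the (63) log-determinant splitting skeleton, and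
(31) ⇒ (32) "no nonzero invariant vector in a semisimple Lie algebra" from Mathlib (`invariant_vector_eq_zero`);
(d) by-name EDGES to the cell records of the papers B10 invokes: [4] = `…Balaban1983to89.B7` Prop. 1 (p. 258 "< 2L²g₀p(g₀)":
`edge_B7Prop1_twoLsq`), [6] = `…Balaban1983to89.B8` Lemma 1 used with α₁ = 0 (pp. 259, 268 "8·3²L²B₃ g p(g)":
`edge_B8Lemma1_alpha1_zero`); [5] = `…B9` ((3.155)–(3.156), (3.183)–(3.185), Sect. E) and [7] = `…B11` (Thm 1, (158),
Sect. F) are cited in docstrings only (no d = 3 record of them is typed).  AUDIT READING OF THEOREM 1 (cell GAPS.md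
G-B10-01, DIVERGENCE.md D-b10.3): E^{(k)} of (62) contains `d(𝔤) log g_k |T₁^{(k)*}|`, so the O(1) of (65)/(66)/(5) is
≥ c·d(𝔤)·|log g_k| and the printed "g_k in a bounded set" must be read as g_k in a COMPACT subset of (0, ∞);
`Thm1PrintedCompact` types that reading (per-k, two-sided hypothesis) and SUPERSEDES — does not replace — `Thm1Printed`,
whose one-sided reading is strictly stronger (`thm1Compact_of_thm1Printed`) and is false at k = 0 for small g₀
(ρ₀(1) = e^{−E}, and by (62), (64) −E contains d(𝔤) Σ_{j<K} |T₁^{(j)*}| log g_j⁻¹ ≥ 3d(𝔤)|T₁^{(0)}| log g₀⁻¹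
≫ O(1)|T₁^{(0)}| as ε → 0, the other terms of (62) being O(1)|T₁^{(j)}| by (25) and the unit-lattice normalisations).
v2.1 (same sub-cell): every quotation and page reference of the Phase-2 docstrings re-checked against the renders
(eqs. (22)–(47) sit one page earlier than v2 said; six paraphrases that v2 had marked as quotations replaced by the
printed sentences; (63): γ₁ is an UPPER bound of C*Δ_kC, as printed).  v2.3 (gen 3 of the sub-cell, docstring
only): the page references of (41)/(47) in the `RunData` docstring corrected to p. 266 [12] / p. 267 [13] (cell
GAPS.md C-pv15-4).  The large-field side of Sect. D is continued in the sibling modules `…B10LargeField` (the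
(38)–(40) domain geometry and the [9] §3.C exponent bookkeeping) and `…B10LargeFieldSum` (the {Ω_j}-summation of
(41): `LargeFieldControlPrinted` below derived from per-plaquette leaves), which import this file and leave it
untouched.  Value = typed skeleton + census + located gaps, NOT summit progress; every `…Printed` Prop remains a
hypothesis.
-/

namespace Literature.MathematicalPhysics.QuantumFieldTheory.Balaban1983to89.B10

/-- One run of the d = 3 construction at statement level (p. 256 [2], (1)–(5)): `K` with `L^K ε = ε₀` ("ε₀ depending
on g only"); `Cfg k` = configurations U on `T_1^{(k)}`; `ρ k` = the densities, `ρ_{k+1} = Tρ_k` (2), `ρ₀(U) =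
exp[−(1/g₀²)A(U) − E]` (1); `χ k` = the characteristic function of (4) `|U(∂p) − 1| < ε₁`; `wilsonBG k U = A^η(U_k(U)) =
Σ_{p⊂T_η} η^{−1}[1 − Re tr U_k(U,∂p)]`, η = L^{−k}, U_k(U) "the minimal configuration constructed in [7]"
(= [Balaban1985Variational]); `sites k = |T_1^{(k)}| = (L^kε)^{−3}|T_ε|`; `g k = g (L^k ε)^{1/2}`; `Ineq41_47 k` =
"ρ_k satisfies the inequalities (41), (47)" (Thm 2's conclusion; (41) p. 266 [12] = the upper-bound representation
after k steps with large-field regions Λ_j, (47) p. 267 [13] = the lower bound), abstract. [cite: Balaban1985UV3, (1)–(5) p.256] -/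
structure RunData where
  K : ℕ
  Cfg : ℕ → Type
  ρ : (k : ℕ) → Cfg k → ℝ
  χ : (k : ℕ) → Cfg k → ℝ
  wilsonBG : (k : ℕ) → Cfg k → ℝ
  sites : ℕ → ℝ
  g : ℕ → ℝ
  Ineq41_47 : ℕ → Prop

/-- The bounds **(5)** p. 256 [2], verbatim: *"χ(U) exp[−(1/g_k²) A^η(U_k(U)) − O(1)|T_1^{(k)}|] ≤ ρ_k(U) ≤
exp O(1)|T_1^{(k)}|"*, for one run with one constant `O1`, all `k ≤ K`. [cite: Balaban1985UV3, (5) p.256] -/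
def Bounds5 (D : RunData) (O1 : ℝ) : Prop :=
  ∀ k, k ≤ D.K → ∀ U : D.Cfg k,
    D.χ k U * Real.exp (-((D.g k)⁻¹ ^ 2 * D.wilsonBG k U) - O1 * D.sites k) ≤ D.ρ k U ∧
    D.ρ k U ≤ Real.exp (O1 * D.sites k)

/-- **Theorem 1**, verbatim (p. 257 [3]): *"The lattice approximations of the three-dimensional pure Yang–Mills
theory with a semi-simple compact group Lie G are ultraviolet stable in the sense that the sequence of densities
ρ_k, constructed by the inductive definition (2), with ρ₀ given by (1), satisfies the bounds (5)."* with (pp. 256–257)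
*"the constant O(1) is independent of ε, k, g_k in a bounded set"* — typed: for every bounded set of couplings
(`gmax`) ONE constant serves all lattice approximations (all runs `i`, i.e. all ε, tori) and all k.  The family of
runs is indexed by an arbitrary type `I`. [cite: Balaban1985UV3, Thm 1 p.257] -/
def Thm1Printed {I : Type} (runs : I → RunData) : Prop :=
  ∀ gmax : ℝ, 0 < gmax → ∃ O1 : ℝ, ∀ i : I, (∀ k, k ≤ (runs i).K → 0 < (runs i).g k ∧ (runs i).g k ≤ gmax) →
    Bounds5 (runs i) O1

/-- **Theorem 2**, verbatim (p. 272 [18]): *"The sequence of densities ρ_k defined by the inductive equations (2),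
with ρ₀ given by (1), satisfies the inequalities (41), (47)."*  ((41), (47) abstract: `Ineq41_47`.) [cite: Balaban1985UV3, Thm 2 p.272] -/
def Thm2Printed {I : Type} (runs : I → RunData) : Prop :=
  ∀ i : I, ∀ k, k ≤ (runs i).K → (runs i).Ineq41_47 k

/-- pp. 272–273 [18–19], *"D. Concluding Remarks. We have to show that the inequalities (41), (47) imply Theorem 1,
i.e. the inequalities (5). … We estimate the interaction terms using the bounds (44)–(46) by
O(1) M₁³ g²_{k−1} p²(g_{k−1}) |Λ_k| ≤ O(1)|T_1^{(k)}|."*  The implication leaf (its printed proof is pp. 272–275;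
the factor `g²_{k−1} p²(g_{k−1}) = O(1)` is where d = 3 superrenormalizability is used — in d = 4 the analogous
large-field sum is the business of the 𝐑 operation, [Balaban1989LargeFieldI]/[Balaban1989LargeFieldII]). [cite: Balaban1985UV3, Sect. D pp.272–275] -/
def Thm1OfThm2Leaf {I : Type} (runs : I → RunData) : Prop := Thm2Printed runs → Thm1Printed runs

/-- Remark **(6)** p. 257 [3]: *"∫dU ρ_k = ∫dU T^k ρ₀ = ∫dU ρ₀ = Z^ε"*, *"they imply uniform in ε bounds for the
partition function Z^ε."*  Re-derived bookkeeping for the UPPER half: for any monotone functional `Int` with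
`Int (const a) = a` (a normalised integral), `ρ_K ≤ exp c` pointwise gives `Int ρ_K ≤ exp c`.  Elementary; no content
of the series. [folklore] -/
theorem partition_upper (X : Type) (Int : (X → ℝ) → ℝ) (ρK : X → ℝ) (c : ℝ)
    (mono : ∀ f g : X → ℝ, (∀ x, f x ≤ g x) → Int f ≤ Int g)
    (const : ∀ a : ℝ, Int (fun _ => a) = a)
    (hup : ∀ U, ρK U ≤ Real.exp c) : Int ρK ≤ Real.exp c := by
  have := mono ρK (fun _ => Real.exp c) hup
  rwa [const] at this

/-! ## Phase 2 (sub-cell `b2b-balaban-b10`): parameters, typed displayed statements, kernel bookkeeping, edges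

Conventions.  Journal page [PDF page].  `O(1)` constants become explicit real parameters.  All `…Printed` Props are
HYPOTHESES downstream; every `theorem` here is either real arithmetic ([folklore]) or a re-derivation of a printed
bookkeeping step from typed leaves (its docstring says which).  Misprints found on the renders are recorded `⟦sic⟧`.
-/

section Parameters

/-- **(7)** p. 257 [3], verbatim: *"We choose the number ε₁ in the same way as in the papers on the Higgs model,
i.e. we take ε₁ = g₀p(g₀), where p(g) = b₀(1 + log g⁻¹)^{p₀}, p₀ > 2 and b₀ is a sufficiently large absolute
constant. Next we proceed as in [9], that is to each term of the decomposition we assign a subset Ω₁ ⊂ T₁ defined as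
a union of big blocks, i.e. blocks of the size M₁, of the unit lattice T₁, such that their distances to P are > RM₁.
We take R = R₁(1 + log g₀⁻¹)^{r₀} = R₁r(g₀)."*  Typed with a real exponent (`Real.rpow`); the window of the first
step is `ε₁ = g₀ p(g₀)` (p. 257), of the k-th step `ε₁ = g_k p(g_k)` (p. 267 [13]).  Print constrains `p₀ > 2` and
leaves `r₀` free (cell GAPS G-B10-02). [cite: Balaban1985UV3, (7) p.257] -/
noncomputable def pFun (b₀ p₀ g : ℝ) : ℝ := b₀ * (1 + Real.log g⁻¹) ^ p₀

/-- `r(g) = (1 + log g⁻¹)^{r₀}` of p. 257 [3] (see `pFun`: *"We take R = R₁(1 + log g₀⁻¹)^{r₀} = R₁r(g₀)"*), and (39)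
p. 266 [12]: `R(g_j) = R₁r(g_j)` — the collar width, in big blocks, of the j-th small-field region. [cite: Balaban1985UV3, (7) p.257] -/
noncomputable def rFun (r₀ g : ℝ) : ℝ := (1 + Real.log g⁻¹) ^ r₀

/-- p. 256 [2], after (5): *"g_k = g(L^kε)^{1/2}"* (d = 3: by (1) `g₀² = g²ε^{4−d} = g²ε`).  The bare coupling `g` is
FIXED; the flow stops at `L^K ε = ε₀`, *"ε₀ is a positive constant depending on the coupling constant g only"* (2). [cite: Balaban1985UV3, (5) p.256] -/
noncomputable def gRun (g L ε : ℝ) (k : ℕ) : ℝ := g * Real.sqrt (L ^ k * ε)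

/-- p. 256 [2], after (5): *"|T₁^{(k)}| = Σ_{y∈T₁^{(k)}} 1 = Σ_{x∈T_η} η³ = (L^kε)^{−3}|T_ε|"*, `|T_ε| = Σ_{x∈T_ε} ε³`
(3). [cite: Balaban1985UV3, (5) p.256] -/
noncomputable def sitesRun (L ε Tε : ℝ) (k : ℕ) : ℝ := (L ^ k * ε)⁻¹ ^ 3 * Tε

/-- Elementary: `0 < g_k`. [folklore] -/
theorem gRun_pos (g L ε : ℝ) (hg : 0 < g) (hL : 0 < L) (hε : 0 < ε) (k : ℕ) : 0 < gRun g L ε k := by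
  unfold gRun; positivity

/-- Elementary: `log g_{k+m} = log g_k + (m/2) log L` — the couplings GROW along the flow in d = 3 (no asymptotic
freedom bookkeeping; contrast [Balaban1987RG1] (0.19)). [folklore] -/
theorem log_gRun_shift (g L ε : ℝ) (hg : 0 < g) (hL : 0 < L) (hε : 0 < ε) (k m : ℕ) :
    Real.log (gRun g L ε (k + m)) = Real.log (gRun g L ε k) + m * (Real.log L / 2) := by
  unfold gRun
  have h1 : 0 < L ^ k * ε := by positivity
  have h2 : 0 < L ^ (k + m) * ε := by positivity
  rw [Real.log_mul hg.ne' (Real.sqrt_pos.mpr h2).ne', Real.log_mul hg.ne' (Real.sqrt_pos.mpr h1).ne',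
    Real.log_sqrt h2.le, Real.log_sqrt h1.le, Real.log_mul (by positivity) hε.ne',
    Real.log_mul (by positivity) hε.ne', pow_add, Real.log_mul (by positivity) (by positivity),
    Real.log_pow, Real.log_pow]
  ring

/-- Elementary: `|log g_{k+m}| ≤ |log g_k| + m (log L)/2` for L ≥ 1 (used in (65) with the log term explicit). [folklore] -/
theorem abs_log_gRun_shift_le (g L ε : ℝ) (hg : 0 < g) (hL : 1 ≤ L) (hε : 0 < ε) (k m : ℕ) :
    |Real.log (gRun g L ε (k + m))| ≤ |Real.log (gRun g L ε k)| + (Real.log L / 2) * m := by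
  rw [log_gRun_shift g L ε hg (by linarith) hε k m]
  have hL' : 0 ≤ Real.log L / 2 := by have := Real.log_nonneg hL; linarith
  calc |Real.log (gRun g L ε k) + ↑m * (Real.log L / 2)|
      ≤ |Real.log (gRun g L ε k)| + |↑m * (Real.log L / 2)| := abs_add_le _ _
    _ = |Real.log (gRun g L ε k)| + (Real.log L / 2) * m := by
        rw [abs_of_nonneg (mul_nonneg (Nat.cast_nonneg m) hL')]; ring

/-- Elementary: `|T₁^{(k+m)}| = L^{−3m}|T₁^{(k)}|` (the factor `L^{−3(j−k)}` of (65)). [folklore] -/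
theorem sitesRun_shift (L ε Tε : ℝ) (k m : ℕ) :
    sitesRun L ε Tε (k + m) = (L ^ 3)⁻¹ ^ m * sitesRun L ε Tε k := by
  unfold sitesRun
  have key : (L ^ m)⁻¹ ^ 3 = (L ^ 3)⁻¹ ^ m := by
    rw [inv_pow, inv_pow, ← pow_mul, ← pow_mul, mul_comm]
  rw [pow_add, show L ^ k * L ^ m * ε = L ^ m * (L ^ k * ε) by ring, mul_inv, mul_pow, key]
  ring

/-- The one real-analysis fact behind the small-field window: for u > −1 and q, c > 0,
`(1+u)^q e^{−cu} ≤ (q/c)^q e^{c−q}` (tangent line of `log` at q/c).  With u = log g⁻¹ this bounds every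
`p(g)^q g^c`, `R(g)ⁿ g^c`. [folklore] -/
theorem rpow_mul_exp_neg_le (q c u : ℝ) (hq : 0 < q) (hc : 0 < c) (hu : -1 < u) :
    (1 + u) ^ q * Real.exp (-(c * u)) ≤ (q / c) ^ q * Real.exp (c - q) := by
  have h1u : 0 < 1 + u := by linarith
  have hqc : 0 < q / c := div_pos hq hc
  have hlog : Real.log (1 + u) ≤ Real.log (q / c) + ((1 + u) / (q / c) - 1) := by
    have := Real.log_le_sub_one_of_pos (div_pos h1u hqc)
    rw [Real.log_div (ne_of_gt h1u) (ne_of_gt hqc)] at this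
    linarith
  rw [Real.rpow_def_of_pos h1u, Real.rpow_def_of_pos hqc, ← Real.exp_add, ← Real.exp_add]
  apply Real.exp_le_exp.mpr
  have hmul : Real.log (1 + u) * q ≤ (Real.log (q / c) + ((1 + u) / (q / c) - 1)) * q :=
    mul_le_mul_of_nonneg_right hlog hq.le
  have hid : ((1 + u) / (q / c) - 1) * q = c * (1 + u) - q := by
    field_simp
  nlinarith [hmul, hid]

/-- Elementary: `0 ≤ log g⁻¹` for `0 < g ≤ 1`. [folklore] -/
theorem log_inv_nonneg_of_le_one {g : ℝ} (hg : 0 < g) (hg1 : g ≤ 1) : 0 ≤ Real.log g⁻¹ :=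
  Real.log_nonneg (one_le_inv_iff₀.mpr ⟨hg, hg1⟩)

/-- Elementary: `p(g) ≥ 0` on (0, 1] for b₀ ≥ 0. [folklore] -/
theorem pFun_nonneg (b₀ p₀ g : ℝ) (hb : 0 ≤ b₀) (hg : 0 < g) (hg1 : g ≤ 1) : 0 ≤ pFun b₀ p₀ g := by
  unfold pFun
  have hu := log_inv_nonneg_of_le_one hg hg1
  exact mul_nonneg hb (Real.rpow_nonneg (by linarith) _)

/-- Elementary: `g² = exp(−2 log g⁻¹)`. [folklore] -/
theorem sq_eq_exp_log (g : ℝ) (hg : 0 < g) : g ^ 2 = Real.exp (-(2 * Real.log g⁻¹)) := by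
  rw [Real.log_inv, show -(2 * -Real.log g) = ((2 : ℕ) : ℝ) * Real.log g by push_cast; ring,
    Real.exp_nat_mul, Real.exp_log hg]

/-- Sect. D first line, p. 272 [18]: *"O(1)M₁³ g²_{k−1} p²(g_{k−1})|Λ_k| ≤ O(1)|T₁^{(k)}|"* — the d = 3
superrenormalizability input `g² p(g)² = O(1)` made quantitative: on (0, 1],
`g² p(g)² ≤ b₀² p₀^{2p₀} e^{2−2p₀}`.  (On a compact [gmin, gmax] ⊄ (0,1] continuity gives a bound too; the cell only
needs the small-coupling half.)  Re-derived, kernel-checked. [cite: Balaban1985UV3, Sect. D p.272] -/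
theorem gsq_psq_le (b₀ p₀ g : ℝ) (hp : 0 < p₀) (hg : 0 < g) (hg1 : g ≤ 1) :
    g ^ 2 * pFun b₀ p₀ g ^ 2 ≤ b₀ ^ 2 * (p₀ ^ (2 * p₀) * Real.exp (2 - 2 * p₀)) := by
  have hu := log_inv_nonneg_of_le_one hg hg1
  have hcore := rpow_mul_exp_neg_le (2 * p₀) 2 (Real.log g⁻¹) (by linarith) (by norm_num) (by linarith)
  rw [show 2 * p₀ / 2 = p₀ by ring] at hcore
  have hb2 : 0 ≤ b₀ ^ 2 := sq_nonneg _
  have hsq : ((1 + Real.log g⁻¹) ^ p₀) ^ 2 = (1 + Real.log g⁻¹) ^ (2 * p₀) := by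
    rw [show (2 : ℝ) * p₀ = p₀ * ((2 : ℕ) : ℝ) by push_cast; ring, Real.rpow_mul (by linarith),
      Real.rpow_natCast]
  calc g ^ 2 * pFun b₀ p₀ g ^ 2
      = b₀ ^ 2 * ((1 + Real.log g⁻¹) ^ (2 * p₀) * Real.exp (-(2 * Real.log g⁻¹))) := by
        unfold pFun; rw [sq_eq_exp_log g hg, mul_pow, hsq]; ring
    _ ≤ b₀ ^ 2 * (p₀ ^ (2 * p₀) * Real.exp (2 - 2 * p₀)) :=
        mul_le_mul_of_nonneg_left hcore hb2

/-- **(11)** p. 258 [4], verbatim: *"exp[−(1/g₀²)[1 − Re tr U(∂p)]] = exp[−(1/2g₀²)|U(∂p) − 1|²] ≤ exp(−½p²(g₀)),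
and by the definition of g₀ = gε^{1/2} the number on the right-hand side is smaller than any positive power of ε."*
The quantitative form of the last clause, re-derived and kernel-checked: for `0 < g ≤ 1`, `p₀ ≥ 1` and `b₀² ≥ N`,
`exp(−½ p(g)²) ≤ g^N` (and `g₀^N = g^N ε^{N/2}`).  (The middle EQUALITY
of (11) presupposes tr = normalised trace and |·| = normalised Hilbert–Schmidt norm — cell DIVERGENCE D-b10.1; with
the operator norm one only has `1 − Re tr U ≥ (2 dim)⁻¹ |U − 1|²`, a harmless constant.) [cite: Balaban1985UV3, (11) p.258] -/
theorem smallFactor_le_pow (b₀ p₀ g : ℝ) (N : ℕ) (hb : 0 ≤ b₀) (hN : (N : ℝ) ≤ b₀ ^ 2) (hp : 1 ≤ p₀)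
    (hg : 0 < g) (hg1 : g ≤ 1) : Real.exp (-(1 / 2) * pFun b₀ p₀ g ^ 2) ≤ g ^ N := by
  set u := Real.log g⁻¹ with hu_def
  have hu : 0 ≤ u := log_inv_nonneg_of_le_one hg hg1
  have h1 : 1 + u ≤ (1 + u) ^ p₀ := by
    have := Real.rpow_le_rpow_of_exponent_le (show (1:ℝ) ≤ 1 + u by linarith) hp
    rwa [Real.rpow_one] at this
  have hp_ge : b₀ * (1 + u) ≤ pFun b₀ p₀ g := by
    unfold pFun; exact mul_le_mul_of_nonneg_left h1 hb
  have hgN : g ^ N = Real.exp (-(N * u)) := by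
    rw [hu_def, Real.log_inv, show -(↑N * -Real.log g) = (N : ℝ) * Real.log g by ring,
      Real.exp_nat_mul, Real.exp_log hg]
  rw [hgN]
  apply Real.exp_le_exp.mpr
  have h0 : 0 ≤ b₀ * (1 + u) := mul_nonneg hb (by linarith)
  have hsq : (b₀ * (1 + u)) ^ 2 ≤ pFun b₀ p₀ g ^ 2 := pow_le_pow_left₀ h0 hp_ge 2
  have hA : b₀ ^ 2 * (2 * u) ≤ (b₀ * (1 + u)) ^ 2 := by nlinarith [sq_nonneg u, sq_nonneg b₀, hu]
  have hB : (N : ℝ) * u ≤ b₀ ^ 2 * u := mul_le_mul_of_nonneg_right hN hu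
  linarith [hA, hB, hsq]

end Parameters

section Theorem1Reading

/-- The bounds (5) AT ONE STEP k (p. 256 [2]; same text as `Bounds5`, which is `∀ k ≤ K` of this). [cite: Balaban1985UV3, (5) p.256] -/
def Bounds5At (D : RunData) (O1 : ℝ) (k : ℕ) : Prop :=
  ∀ U : D.Cfg k,
    D.χ k U * Real.exp (-((D.g k)⁻¹ ^ 2 * D.wilsonBG k U) - O1 * D.sites k) ≤ D.ρ k U ∧
    D.ρ k U ≤ Real.exp (O1 * D.sites k)

/-- `Bounds5` is the conjunction over k ≤ K of `Bounds5At` (definitional). [folklore] -/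
theorem bounds5_iff (D : RunData) (O1 : ℝ) : Bounds5 D O1 ↔ ∀ k, k ≤ D.K → Bounds5At D O1 k :=
  Iff.rfl

/-- **Theorem 1, audit reading** (p. 257 [3], same verbatim text as `Thm1Printed`: *"… satisfies the bounds (5)"*,
with pp. 256–257 *"the constant O(1) is independent of ε, k, g_k in a bounded set"* and p. 256 (4) *"The constant O(1)
goes to ∞ as g → 0"*), typed with the uniformity clause read as: for every COMPACT coupling window
`[gmin, gmax] ⊂ (0, ∞)` one constant serves all runs i and all steps k WHOSE g_k lies in the window.  Why this reading
(cell GAPS G-B10-01): the printed Sect. D argument bounds |E_k| through (62), whose term `d(𝔤) log g_k |T₁^{(k)*}|` is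
`≍ |log g_k|` per site, so the O(1) of (65), (66), (5) grows like `d(𝔤)|log g_k|`; at k = 0, ρ₀(1) = e^{−E} where, by
(62) and (64), −E contains the terms `d(𝔤)|T₁^{(j)*}| log g_j⁻¹` (j < K) — for j = 0 alone `3d(𝔤)|T₁^{(0)}| log g₀⁻¹`,
unbounded per site as ε → 0 (the other three terms of (62) are O(1)|T₁^{(j)}|: σ₀ and Z^{(j)}(T, 1) are g-independent
unit-lattice normalisations, Σ_X 𝒫′ = O(g_j)|T₁^{(j)}| by (25)) — so that, up to those O(1)|T| terms,
`−E ≥ 3d(𝔤)|T₁^{(0)}| log g₀⁻¹ − O(1)|T₁^{(0)}|` (taking (62) literally), which violates the upper bound of (5) with a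
g₀-independent constant.  `Thm1Printed`
(one-sided window, per-run hypothesis) is strictly stronger (`thm1Compact_of_thm1Printed`); this declaration
SUPERSEDES it for downstream use and does not delete it. [cite: Balaban1985UV3, Thm 1 p.257] -/
def Thm1PrintedCompact {I : Type} (runs : I → RunData) : Prop :=
  ∀ gmin gmax : ℝ, 0 < gmin → gmin ≤ gmax → ∃ O1 : ℝ, ∀ i : I, ∀ k, k ≤ (runs i).K →
    gmin ≤ (runs i).g k → (runs i).g k ≤ gmax → Bounds5At (runs i) O1 k

/-- `Thm1Printed` ⇒ `Thm1PrintedCompact` for any family whose couplings are positive and uniformly bounded above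
(in the paper `g_k ≤ g ε₀^{1/2}` for every run, g and ε₀ being fixed, p. 256).  The converse fails (see the docstring of
`Thm1PrintedCompact`).  Elementary. [folklore] -/
theorem thm1Compact_of_thm1Printed {I : Type} (runs : I → RunData) (gtop : ℝ) (htop : 0 < gtop)
    (hg : ∀ i k, k ≤ (runs i).K → 0 < (runs i).g k ∧ (runs i).g k ≤ gtop)
    (h : Thm1Printed runs) : Thm1PrintedCompact runs := by
  intro gmin gmax _ _
  obtain ⟨O1, hO1⟩ := h gtop htop
  exact ⟨O1, fun i k hk _ _ => hO1 i (hg i) k hk⟩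

end Theorem1Reading

section SectionA

/-- Abstract carrier of a polymer ("localization") expansion `Σ_X 𝒫′(g, X, U)` (pp. 262–265 [8–11]): `Poly` = the
localizations X (connected unions of big blocks contained in cubes of size R M₁, p. 263), `ℒ X` = 𝓛(X) of
ref. [19] (= [Gawędzki–Kupiainen]) — the length of a shortest tree through the blocks of X, `act X U` = 𝒫′(g, X, U). [cite: Balaban1985UV3, (24)–(25) p.262] -/
structure PolymerActivities where
  Poly : Type
  Cfg : Type
  ℒ : Poly → ℝ
  act : Poly → Cfg → ℝ

/-- **(25)** p. 262 [8], verbatim: *"|𝒫′₁(g₀, X, U₁)| ≤ O(g₀) e^{−κ𝓛(X)}, where κ can be arbitrarily large if M₁ is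
sufficiently large. Besides the bounds (25) the expressions 𝒫′₁ have three very important properties"* — p. 263 [9]:
(26) gauge invariance, then *"The second is a localization property with respect to U₁. … The third property is the
analyticity with respect to U₁. These properties follow from the results of previous papers"*; followed by the
renormalisation of 𝒫′₁, (27)–(35) pp. 263–265 ((27)–(28) the variables B(c) and their bound, (29)–(30) the expansion
in 𝓗(B) up to the sixth order, (31) ⇒ (32) no linear term — see `invariant_vector_eq_zero`, (33)–(35) the quadratic
term); p. 270 [16]: *"The terms 𝒫′_{k+1} satisfy the bound (25) (with the indices 1, 0
replaced by k+1, k)"*; p. 273: *"From (25), which holds for arbitrary j, …"*.  Typed as the bound only ((26) needs a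
gauge-group action the carrier does not name).  Printed proof: pp. 261–262, by the cluster expansion (23) "as in
[9], [10]" ((Higgs)₂,₃) — by reference; the analyticity radius in U₁ needed for the Cauchy bound (30) (p. 263) is not
stated (cell census S-A7, GAPS G-B10-04). [cite: Balaban1985UV3, (25) p.262] -/
def Bound25Printed (A : PolymerActivities) (g κ C : ℝ) : Prop :=
  ∀ (X : A.Poly) (U : A.Cfg), |A.act X U| ≤ C * g * Real.exp (-(κ * A.ℒ X))

/-- **(31) ⇒ (32)** p. 264 [10], verbatim: *"The gauge invariance (26) implies the invariance with respect to the
global transformations R(U), U ∈ G, hence the equality (31) R(U)((δ/δ𝓗(b))𝒫′₁)(g₀, X, 1) = ((δ/δ𝓗(b))𝒫′₁)(g₀, X, 1).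
We have to notice only that (26) holds for all regular gauge field configurations, not only for the minimal
configurations U₁. The derivative in the above formula is an element of the Lie algebra 𝔤, and by the assumption that
𝔤 is semi-simple, the only element invariant is 0, and we conclude (32) ((δ/δ𝓗(b))𝒫′₁)(g₀, X, 1) = 0. It is the only
place we use the semi-simplicity, but the above conclusion is a fundamental point in our method. In the
renormalization group language it is the statement that there are no relevant variables in the effective action."*
The Lie-algebra fact, kernel-checked from Mathlib (`LieAlgebra.center_eq_bot` for `LieAlgebra.IsSemisimple`):
a vector annihilated by every `ad x` lies in the centre, which is trivial.  (The printed hypothesis is invariance under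
the adjoint GROUP R(U), U ∈ G; differentiating along one-parameter subgroups gives the `ad`-invariance used here —
that differentiation step is not typed.  Note: semisimple suffices, as printed; cell GAPS C-B10-4.) [cite: Balaban1985UV3, (31)–(32) p.264] -/
theorem invariant_vector_eq_zero {R L : Type*} [CommRing R] [LieRing L] [LieAlgebra R L]
    [LieAlgebra.IsSemisimple R L] (v : L) (h : ∀ x : L, ⁅x, v⁆ = 0) : v = 0 := by
  have hv : v ∈ LieAlgebra.center R L := h
  rw [LieAlgebra.center_eq_bot] at hv
  exact hv

/-- **(63)** pp. 271–272 [17–18] (the splitting of `−½ Tr log C*Δ_k C` into a local integral, a constant and a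
convergent series), scalar skeleton re-derived for one eigenvalue m > 0 and a = 2γ₁ > 0:
`−½ log m = ½(log(m + a) − log m) − ½ log a − ½ log(1 + m/a)`; in print the three pieces are
`½∫₀^{2γ₁} dx (C*Δ_kC + x)⁻¹`, `−½ log(2γ₁)·Tr 1` ⟦printed "−½ C*Δ_kC", sic⟧ and the contour-integral series
`Σ_{n≥1} (−1)ⁿ(2n)⁻¹ (m/2γ₁)ⁿ = −½ log(1 + m/2γ₁)` ⟦circle radius printed γ₁ and cut printed [2γ₁, 0]: read 2γ₁ and
[−2γ₁, 0]; a `Tr` is missing in the last sum⟧ — verified on the render; only this algebraic identity is kernel-checked,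
the operator calculus is by reference / asserted (cell census S-C3, S-C4, GAPS G-B10-06): p. 272 [18] *"The number γ₁
is an upper bound of the positive, bounded operator C*Δ_kC"* (this UPPER bound is what makes the series in
C*Δ_kC/2γ₁ converge; its uniformity in k and in the background is not stated), positivity of ⟨A, C*Δ_kCA⟩ from
[5] Sect. E (p. 271), and *"The operator G̃₃(x) has the same properties as G̃₂, especially it can be represented by a
generalized random walk expansion"* (p. 272) uniformly in x ∈ (0, 2γ₁] — by analogy. [cite: Balaban1985UV3, (63) pp.271–272] -/
theorem logdet63_skeleton (m a : ℝ) (hm : 0 < m) (ha : 0 < a) :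
    -(1 / 2) * Real.log m
      = (1 / 2) * (Real.log (m + a) - Real.log m) - (1 / 2) * Real.log a
        - (1 / 2) * Real.log (1 + m / a) := by
  have h1 : Real.log (m + a) = Real.log a + Real.log (1 + m / a) := by
    rw [← Real.log_mul (ne_of_gt ha) (by positivity)]
    congr 1; field_simp; ring
  rw [h1]; ring

end SectionA

section Tower

/-- Second local carrier: one run TOGETHER WITH the shape of the inductive inequalities (41) p. 266 [12] and (47)
p. 267 [13].  `Hist k` = the large-field histories `{Ω_j, Λ_j, Z_j, V_j}_{j<k}` summed/integrated over in (41)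
("Σ_{{Ω_j}} ∫dV_{k−1}↾_{Z_{k−1}} δ(V̄_{k−1}V^{−1}) ⋯ ∫dV₀↾_{Z₀} δ(V̄₀V₁^{−1}) χ_k ζ_{Λ_{k−1}} χ_{k−1} ⋯ ζ_{Λ₁} χ₁ ζ_{Ω₁^c}");
`triv k` = the history with no large fields (every Ω_j the whole lattice; the only term of (47));
`LF k U F` = that sum/integral, characteristic functions included, applied to `exp ∘ F` — abstractly a functional
MONOTONE in F (`lf_mono`) and multiplicative on constants (`lf_shift`: LF(F + t) = eᵗ LF(F));
`mainT k h U = (1/g_k²) A^η(U_k)`, U_k = U_k(V, {V_j}) the composite minimal configuration (42), equal at the trivial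
history to the `(1/g_k²)A^η(U_k(U))` of (5) (`mainT_triv`); `Pint k h U = Σ_{j=1}^k Σ_{Y_j} 𝒫_j(Y_j, U_k)` (43);
`Λvol k h = |Λ_k| ≤ |T₁^{(k)}|`; `Zterm k h = Σ_{j=0}^{k−1} O(log g_j⁻¹)|Z_j|` (zero at the trivial history);
`Ecst k = E_k` with (64) `E_k = Σ_{j=k}^{K−1} E^{(j)}` (`Estep j = E^{(j)}` of (62), `Ecst_eq`);
`Rm k = Σ_{j=0}^{k−1} O((L^jε)^{3+κ₀})|T₁^{(j)}|`; `χ ≥ 0`, `|T₁^{(k)}| ≥ 0`; `M₁, b₀, p₀` the parameters of (7),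
(38).  Only NAMES the printed functionals; no construction is asserted. [cite: Balaban1985UV3, (41) + (47) pp.266–267] -/
structure TowerRun extends RunData where
  Hist : ℕ → Type
  triv : (k : ℕ) → Hist k
  LF : (k : ℕ) → Cfg k → (Hist k → ℝ) → ℝ
  lf_mono : ∀ (k : ℕ) (U : Cfg k) (F G : Hist k → ℝ), (∀ h, F h ≤ G h) → LF k U F ≤ LF k U G
  lf_shift : ∀ (k : ℕ) (U : Cfg k) (F : Hist k → ℝ) (t : ℝ),
    LF k U (fun h => F h + t) = Real.exp t * LF k U F
  mainT : (k : ℕ) → Hist k → Cfg k → ℝ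
  mainT_triv : ∀ (k : ℕ) (U : Cfg k), mainT k (triv k) U = (g k)⁻¹ ^ 2 * wilsonBG k U
  Pint : (k : ℕ) → Hist k → Cfg k → ℝ
  Λvol : (k : ℕ) → Hist k → ℝ
  Λvol_le : ∀ (k : ℕ) (h : Hist k), Λvol k h ≤ sites k
  Zterm : (k : ℕ) → Hist k → ℝ
  Zterm_triv : ∀ k, Zterm k (triv k) = 0
  Ecst : ℕ → ℝ
  Estep : ℕ → ℝ
  Ecst_eq : ∀ k, Ecst k = ∑ j ∈ Finset.Ico k K, Estep j
  Rm : ℕ → ℝ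
  χ_nonneg : ∀ (k : ℕ) (U : Cfg k), 0 ≤ χ k U
  sites_nonneg : ∀ k, 0 ≤ sites k
  M₁ : ℝ
  b₀ : ℝ
  p₀ : ℝ

/-- **(41)** p. 266 [12] (*"Our inductive assumption has the following form"*), verbatim:
*"ρ_k(V) ≤ Σ_{{Ω_j}} ∫dV_{k−1}↾_{Z_{k−1}} δ(V̄_{k−1}V^{−1}) ⋯ ∫dV₀↾_{Z₀} δ(V̄₀V₁^{−1})
χ_k ζ_{Λ_{k−1}} χ_{k−1} · … · ζ_{Λ₁} χ₁ ζ_{Ω₁^c} × exp[−(1/g_k²)A^η(U_k) + Σ_{j=1}^{k} Σ_{Y_j} 𝒫_j(Y_j, U_k) − E_k +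
Σ_{j=0}^{k−1} O(log g_j⁻¹)|Z_j| + Σ_{j=0}^{k−1} O((L^jε)^{3+κ₀})|T₁^{(j)}|]"* ("the inductive assumption", with the
geometric setting (38)–(40) and the composite gauge (42)), over the carrier `TowerRun`. [cite: Balaban1985UV3, (41) p.266] -/
def Ineq41 (T : TowerRun) (k : ℕ) : Prop :=
  ∀ U : T.Cfg k, T.ρ k U ≤
    T.LF k U (fun h => -(T.mainT k h U) + T.Pint k h U - T.Ecst k + T.Zterm k h + T.Rm k)

/-- **(47)** p. 267 [13], verbatim: *"Analogously to (37) we assume the lower bound ρ_k(V) ≥ χ_k exp[−(1/g_k²)A^η(U_k)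
+ Σ_{j=1}^k Σ_{Y_j} 𝒫_j(Y_j, U_k) − E_k − Σ_{j=0}^{k−1} O((L^jε)^{3+κ₀})|T₁^{(j)}|], where the characteristic function χ_k
corresponds to the restrictions on V given by the conditions |U_k(∂p) − 1| < g_kp(g_k)η², p ⊂ T_η."* — the term of
the trivial history (no large fields, no integrations; p. 272: *"all simplifications coming from the fact that
Ω_{k+1} = T_η"*). [cite: Balaban1985UV3, (47) p.267] -/
def Ineq47 (T : TowerRun) (k : ℕ) : Prop :=
  ∀ U : T.Cfg k, T.χ k U *
    Real.exp (-(T.mainT k (T.triv k) U) + T.Pint k (T.triv k) U - T.Ecst k - T.Rm k) ≤ T.ρ k U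

/-- Binding of `RunData.Ineq41_47` (unit r2's abstract "ρ_k satisfies (41), (47)") to the typed shapes: a hypothesis on
the carrier, not a claim. [folklore] -/
def SpecOK (T : TowerRun) : Prop := ∀ k, T.Ineq41_47 k ↔ (Ineq41 T k ∧ Ineq47 T k)

/-- k = 0: by **(1)** p. 256 [2] *"ρ₀(U) = exp[−(1/g₀²)A(U) − E]"* both (41) and (47) hold at k = 0 with no large
fields, no interaction terms, E₀ = E (p. 265 [11]: "E₁ = E − E^{(0)}"; p. 271 [17]: "E_{k+1} = E_k − E^{(k)}"; (64): so
E₀ = E = Σ_{j<K} E^{(j)}) and no remainder — the base of the induction behind Thm 2, left as a leaf (it is an identity about the objects the carrier only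
names). [cite: Balaban1985UV3, (1) p.256] -/
def Step0Printed (T : TowerRun) : Prop := Ineq41 T 0 ∧ Ineq47 T 0

/-- **(36)–(37)**, Sect. A conclusion, p. 265 [11], verbatim: *"Gathering together the inequalities and transformations
we obtain finally (36) (Tρ₀)(V) = ρ₁(V) ≤ Σ_{Ω₁} χ₁ ∫dV₀↾_{Ω₁^c} δ(V̄₀V^{−1}) ζ_{Ω₁^c} × exp[−(1/g₁²)A^{L^{−1}}(U₁)
+ Σ_Y 𝒫₁(g₀, Y, U₁) − E₁ + O(log g₀⁻¹)|Ω₁^c| + O(ε^{3+κ₀})|T₁|], where g₁ = g(Lε)^{1/2}, E₁ = E − E^{(0)}, and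
E^{(0)} = log σ₀|T₁*| + d(𝔤) log g₀|T₁*| + log Z^{(0)}(T₁, 1) + Σ_X 𝒫′₁(g₀, X, 1). This inequality is the basis of our
inductive assumption in the next section. … Let us make a remark about a lower bound. We introduce restrictions on
fields in a slightly different way. The characteristic function χ₁ denotes restrictions on V of the form
|U₁(∂p) − 1| < L⁻²g₀p(g₁) ⟦sic: g₁p(g₁), cf. (47)⟧, where U₁ = U₁(V) is the minimal configuration determined by V.
The restrictions on A are introduced as in (18), and we perform the same operations on the whole lattice as on the
sets Ω₁. They give the inequality (37) ρ₁(V) ≥ χ₁ exp[−(1/g₁²)A^{L^{−1}}(U₁) + Σ_Y 𝒫₁(g₀, Y, U₁) − E₁ −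
O(ε^{3+κ₀})|T₁|]."* — i.e. (41), (47) at k = 1.  Printed proof = Sect. A pp. 257–265 (steps (8)–(35): decomposition
of unity (7)–(8), axial gauge fixing (9) and [6], translation to the minimizer [7] (12)–(13), linearisation (14)–(21),
cluster expansion (23) "as in [9], [10]", Cauchy bounds (30), no relevant terms (31)–(32), second-order term
(33)–(35)); located census items S-A4 ((22) p. 261: Ṽ, Z^{(0)}(Ω₁, U₁), C^{(0)}(Ω₁, U₁) undefined in print; GAPS
G-B10-03), S-A7 ((30) p. 263: analyticity radius; G-B10-04), (35) p. 265 asserted. [cite: Balaban1985UV3, (36)–(37) p.265] -/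
def FirstStep36_37Printed (T : TowerRun) : Prop := 1 ≤ T.K → Ineq41 T 1 ∧ Ineq47 T 1

/-- **Sect. C** pp. 267–272 [13–18], verbatim frame: *"We apply the renormalization transformation T to the density
ρ_k, and we use the inductive inequality (41). Thus the density ρ_{k+1} is bounded by a sum of terms obtained by
application of the renormalization transformation T to terms on the right-hand side of (41). Now we do the same
operations as in the first step."* (p. 267) … (48)–(60) … *"Complementing the constants in (55) to the full lattice
T^{(k)}, and gathering together all the transformations and estimates, we obtain the inductive inequality (41) for k
replaced by k + 1, but with the additional term (61)"* (p. 271) … (62)–(63) … *"Thus we have estimated ρ_{k+1} by an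
expression which is almost equal to the right-hand side of the inductive assumption (41) for k + 1. To get the exact
inequality we estimate a sum of all terms 𝒫_j(Y_j, U_{k+1}) with localizations Y_j not contained in Ω_{k+1} by
O(1)|Λ_k|, or by O(1)|Z_k|. The lower bound is proved in the same way, with all simplifications coming from the fact
that Ω_{k+1} = T_η. Thus we have proved. Theorem 2."* (p. 272) — the inductive step as ONE leaf.  Located census items
(cell GAPS): S-C1 (p. 268) composite minimizer "If we substitute it in U_k in place of V_k↾_{Λ_k}, we get the
configuration U_{k+1}" by ref. [7] (G-B10-08); S-C2 (p. 268) `|V′_k − 1| < 16·3²L²B₃g_kp(g_k)` = Lemma 1 of [6] with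
α₁ = 0 (`edge_B8Lemma1_alpha1_zero`); p. 270 the extension of (44) "to an arbitrary configuration having the same
properties and bounds as U_k" asserted (G-B10-05); S-C3/S-C4 (pp. 271–272) the operator calculus of (63) by reference
to [5] Sect. E / by analogy (G-B10-06); S-C5 (pp. 271–272) the two absorptions "Complementing the constants … to the
full lattice" and "by O(1)|Λ_k|, or by O(1)|Z_k|" unwritten (G-B10-07); S-C6 the lower bound in one sentence;
misprints (49) χ_{k−1} ⟦χ_{k+1}⟧, p. 269 "O(g⁷p¹⁸(g_k))" ⟦g_k⁷⟧, (63) (see `logdet63_skeleton`). [cite: Balaban1985UV3, Sect. C pp.267–272] -/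
def SectCStepPrinted (T : TowerRun) : Prop :=
  ∀ k, 1 ≤ k → k + 1 ≤ T.K → (Ineq41 T k ∧ Ineq47 T k) → (Ineq41 T (k + 1) ∧ Ineq47 T (k + 1))

/-- **Theorem 2 from its printed parts**: (1) at k = 0, Sect. A at k = 1, Sect. C for k → k+1 (1 ≤ k) give (41) ∧ (47)
for every k ≤ K — the induction the paper leaves implicit (p. 265: (36) "is the basis of our inductive assumption in
the next section"; p. 267: "we use the inductive inequality (41). Thus the density ρ_{k+1} is bounded by …"; p. 271:
"we obtain the inductive inequality (41) for k replaced by k + 1"; p. 272 Thm 2).  Re-derived bookkeeping over the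
leaves; no content of the series. [cite: Balaban1985UV3, Thm 2 p.272] -/
theorem ineqs_of_sections (T : TowerRun) (h0 : Step0Printed T) (hA : FirstStep36_37Printed T)
    (hC : SectCStepPrinted T) : ∀ k, k ≤ T.K → Ineq41 T k ∧ Ineq47 T k := by
  intro k
  induction k with
  | zero => exact fun _ => h0
  | succ k ih =>
    intro hk
    rcases Nat.eq_zero_or_pos k with h | h
    · subst h; exact hA (by omega)
    · exact hC k h hk (ih (by omega))

/-- Family form of `ineqs_of_sections`: the three printed parts for every run give `Thm2Printed` (through the binding
`SpecOK`).  Re-derived bookkeeping. [cite: Balaban1985UV3, Thm 2 p.272] -/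
theorem thm2_of_sections {I : Type} (T : I → TowerRun) (hspec : ∀ i, SpecOK (T i))
    (h0 : ∀ i, Step0Printed (T i)) (hA : ∀ i, FirstStep36_37Printed (T i)) (hC : ∀ i, SectCStepPrinted (T i)) :
    Thm2Printed (fun i => (T i).toRunData) := by
  intro i k hk
  exact ((hspec i) k).mpr (ineqs_of_sections (T i) (h0 i) (hA i) (hC i) k hk)

/-- **(46)** p. 267 [13], verbatim: *"Summation over y gives the factor (M₁L^jη)^{−3}|Λ_k|, and finally summation over
j = 1, …, k gives the following bound for the sum of interaction terms in (41), (46) Σ_{j=1}^k Σ_{Y_j} |𝒫_j(Y_j, U_k)|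
≤ O(1)M₁³g²_{k−1}p²(g_{k−1})|Λ_k|. Thus the sum is not only convergent, but also small."*, from (43)–(45): (43) (p. 266)
*"|𝒫_j(Y_j)| ≤ O(1) Π_{i=1}^n exp(−κ₁(M₁L^jη)^{−1}|c_{i,−} − y|)"*, n ≥ 2; (44) (p. 267) the regularity *"|U_k(∂p) − 1|
< 2L²B₃g_{k−1}p(g_{k−1})η²"* of the minimizer inserted; (45) *"By the assumption n ≥ 2, summation over all Y_j with y
fixed yields for g_{k−1} sufficiently small Σ_{Y_j: y=y₀} |𝒫_j(Y_j, U_k)| ≤ O(1)(O(M₁³)g_{k−1}p(g_{k−1}))²(L^jη)⁴"*; and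
p. 267: *"Because n ≥ 2, so L^{−2n} ≤ L^{−4} and the functions 𝒫_j(Y_j, U_k) behave like irrelevant variables in the
dimensions 3, although in bounds only, not in exact scaling properties. … In the four-dimensional case the functions
𝒫_j(Y_j, U_k) with n = 2 behave like marginal variables, and an additional renormalization, a coupling constant
renormalization, is needed."* (see `powerCounting_d3` / `powerCounting_d4`).  Typed at the history level (|Λ_k| =
`Λvol`); the coefficient O(1) = `C`.  Proof printed pp. 266–267 modulo (44) (= [7] regularity) — census (cell GAPS
C-B10-1): the M₁-power in (45) is not load-bearing (M₁ is fixed before g is taken small). [cite: Balaban1985UV3, (46) p.267] -/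
def Bound46Printed (T : TowerRun) : Prop :=
  ∃ C : ℝ, 0 ≤ C ∧ ∀ k, 1 ≤ k → k ≤ T.K → ∀ (h : T.Hist k) (U : T.Cfg k),
    |T.Pint k h U| ≤ C * T.M₁ ^ 3 * ((T.g (k - 1)) ^ 2 * (pFun T.b₀ T.p₀ (T.g (k - 1))) ^ 2) * T.Λvol k h

/-- **(45) ⇒ (46), the d = 3 power counting**, re-derived: summing (45) over the (M₁L^jη)^{−3}|Λ_k| blocks y and over
j = 1 … k produces `Σ_j (L^{j−k})^{4−d}`; for d = 3 this is the geometric sum `Σ_{m<k} (L^{−1})^m ≤ L/(L − 1)`,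
uniformly in k. [cite: Balaban1985UV3, (45)–(46) p.267] -/
theorem powerCounting_d3 (L : ℝ) (hL : 1 < L) (k : ℕ) :
    ∑ m ∈ Finset.range k, (L⁻¹ ^ m) ^ (4 - 3) ≤ L / (L - 1) := by
  have h0 : 0 ≤ L⁻¹ := inv_nonneg.mpr (by linarith)
  have h1 : L⁻¹ < 1 := inv_lt_one_of_one_lt₀ hL
  have hL0 : L ≠ 0 := by positivity
  calc ∑ m ∈ Finset.range k, (L⁻¹ ^ m) ^ (4 - 3) = ∑ m ∈ Finset.range k, L⁻¹ ^ m := by simp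
    _ ≤ ∑' m, L⁻¹ ^ m :=
        (summable_geometric_of_lt_one h0 h1).sum_le_tsum _ (fun i _ => pow_nonneg h0 i)
    _ = (1 - L⁻¹)⁻¹ := tsum_geometric_of_lt_one h0 h1
    _ = L / (L - 1) := by field_simp

/-- … whereas for d = 4 the same sum is `Σ_{m<k} 1 = k`, unbounded in the number of steps: the printed "marginal
variables" remark of p. 267 [13] in one line (cell GAPS G-r2.5a(ii) / G-adv3-1: [Balaban1988Convergent] §3 takes
"almost all operations and bounds" from "[16, I]"; this d = 3 power counting is the one bound it cannot take from
[16] = this paper). [cite: Balaban1985UV3, p.267 remark after (46)] -/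
theorem powerCounting_d4 (L : ℝ) (k : ℕ) :
    ∑ m ∈ Finset.range k, (L⁻¹ ^ m) ^ (4 - 4) = k := by simp

/-- Sect. D first line (p. 272 [18]) from the leaf (46): if every `g_{k−1} ∈ (0, 1]` then
`|Σ𝒫| ≤ C M₁³ b₀² p₀^{2p₀} e^{2−2p₀} |T₁^{(k)}|` for 1 ≤ k ≤ K — the interaction terms are O(1)|T₁^{(k)}| with an
HONEST O(1) (independent of k, ε and of g_k ≤ 1).  Re-derived from `Bound46Printed` + `gsq_psq_le` + |Λ_k| ≤ |T₁^{(k)}|. [cite: Balaban1985UV3, Sect. D p.272] -/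
theorem Pint_le_of_bound46 (T : TowerRun) (hp : 0 < T.p₀) (hM : 0 ≤ T.M₁) (h46 : Bound46Printed T)
    (hg : ∀ k, k ≤ T.K → 0 < T.g k ∧ T.g k ≤ 1) (hΛ : ∀ (k : ℕ) (h : T.Hist k), 0 ≤ T.Λvol k h) :
    ∃ a : ℝ, ∀ k, 1 ≤ k → k ≤ T.K → ∀ (h : T.Hist k) (U : T.Cfg k), |T.Pint k h U| ≤ a * T.sites k := by
  obtain ⟨C, hC0, hC⟩ := h46
  refine ⟨C * T.M₁ ^ 3 * (T.b₀ ^ 2 * (T.p₀ ^ (2 * T.p₀) * Real.exp (2 - 2 * T.p₀))), ?_⟩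
  intro k hk1 hkK h U
  have hgk := hg (k - 1) (by omega)
  have hgp := gsq_psq_le T.b₀ T.p₀ (T.g (k - 1)) hp hgk.1 hgk.2
  have hCM : 0 ≤ C * T.M₁ ^ 3 := mul_nonneg hC0 (pow_nonneg hM 3)
  calc |T.Pint k h U| ≤ C * T.M₁ ^ 3 * ((T.g (k - 1)) ^ 2 * (pFun T.b₀ T.p₀ (T.g (k - 1))) ^ 2) * T.Λvol k h :=
        hC k hk1 hkK h U
    _ ≤ C * T.M₁ ^ 3 * (T.b₀ ^ 2 * (T.p₀ ^ (2 * T.p₀) * Real.exp (2 - 2 * T.p₀))) * T.Λvol k h :=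
        mul_le_mul_of_nonneg_right (mul_le_mul_of_nonneg_left hgp hCM) (hΛ k h)
    _ ≤ C * T.M₁ ^ 3 * (T.b₀ ^ 2 * (T.p₀ ^ (2 * T.p₀) * Real.exp (2 - 2 * T.p₀))) * T.sites k :=
        mul_le_mul_of_nonneg_left (T.Λvol_le k h) (mul_nonneg hCM (by positivity))

/-- **(67)–(71) + ref. [9] Sect. 3.C**, pp. 273–274 [19–20], verbatim: *"To prove the inequality (5) we have to produce
all small factors connected with large fields regions P in the functions ζ_{Λ_j}. Let us take a plaquette p′ ⊂ Λ_j
and such that |V_j(∂p′) − 1| ≥ g_jp(g_j). We have (67) Ū_k^j = V_j on Λ_j, and the configuration U_k satisfies the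
following regularity condition on B^j(Λ_j). (68) |U_k(∂p) − 1| < O(1)g_jp(q_j)L^{−2j} ⟦sic: p(g_j)⟧. Applying the
inequalities (50), (53) [4], we have (69) … Squaring both sides of the above inequality and using (67) yields (70) …
This inequality can be written finally as (71) (1/g_k²) Σ_{p⊂Δ′} η⁻¹[1 − Re tr U_k(∂p)] ≥ (1/2g_j²)|V_j(∂p′) − 1|²
− O(1)g_jp³(g_j) ≥ ½p²(g_j) − O(1)g_jp³(g_j) ≥ ¼p²(g_j) for g_j sufficiently small. … We get these small factors for
all plaquettes in all large fields set P. Results related to stability bound (70) have been obtained by P. Federbush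
in [17, 18]. The analysis of Sect. 3.C [9], which is model independent, show that these small factors are enough to
control all sums in (41), together with the second term in (65) ⟦sic: (66)⟧. This gives the upper bound in (5)."*
([9] = (Higgs)₂,₃ II).  Typed as the ONE inequality Sect. D needs: the history functional applied to the main term plus the Z-terms alone is ≤ e^{d|T₁^{(k)}|}.
BY REFERENCE to [9]; cell objection G-B10-02: a scale-i large-field plaquette forces collars Z_j at every later scale
j ≥ i (p. 268 rule), costing ≍ (1 + log g_i⁻¹)^{2+3r₀} against the gain ¼p²(g_i) = ¼b₀²(1 + log g_i⁻¹)^{2p₀}; print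
fixes p₀ > 2 and leaves r₀ free — the bookkeeping closes for p₀ > 1 + 3r₀/2, a choice the paper does not state. [cite: Balaban1985UV3, (67)–(71) pp.273–274] -/
def LargeFieldControlPrinted (T : TowerRun) : Prop :=
  ∃ d : ℝ, 0 ≤ d ∧ ∀ k, k ≤ T.K → ∀ U : T.Cfg k,
    T.LF k U (fun h => -(T.mainT k h U) + T.Zterm k h) ≤ Real.exp (d * T.sites k)

/-- **(71)** arithmetic, kernel-checked: if `O(1) g p(g) · p(g)… ≤ ¼`, precisely `C g p ≤ 1/4`, then
`½p² − C g p³ ≥ ¼p²`. [cite: Balaban1985UV3, (71) p.273] -/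
theorem eq71_arith (p g C : ℝ) (h : C * g * p ≤ 1 / 4) : p ^ 2 / 4 ≤ p ^ 2 / 2 - C * g * p ^ 3 := by
  nlinarith [mul_nonneg (sq_nonneg p) (by linarith : (0:ℝ) ≤ 1 / 4 - C * g * p)]

/-- **(70)** squaring step p. 273 [19] (*"Squaring both sides of the above inequality and using (67) yields (70)
|V_j(∂p′) − 1|² < Σ_{x∈B^j(x₀)} L^{−j} Σ_{p⊂(p′)_x} |U_k(∂p) − 1|² + O(1)(g_jp(g_j))³"*), kernel-checked arithmetic: with
`0 ≤ s ≤ A` (s = the block average Σ_x L^{−3j} Σ_{p⊂(p′)_x} |U_k(∂p) − 1| of (69), A = O(1)g_jp(g_j) by (68)) and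
`0 ≤ b ≤ B` (b = the curvature term of (69), B = O(1)(g_jp(g_j))²), `(s + b)² ≤ s² + (2AB + B²)` — the cross terms
are the `O(1)(g_jp(g_j))³` of (70); the remaining step s² ≤ Σ_x L^{−j} Σ_p |·|² is Cauchy–Schwarz over the L^{2j} fine
plaquettes of a block plaquette (cell GAPS C-B10-2). [cite: Balaban1985UV3, (70) p.273] -/
theorem eq70_sq_step (s b A B : ℝ) (hs0 : 0 ≤ s) (hs : s ≤ A) (hb0 : 0 ≤ b) (hbB : b ≤ B) :
    (s + b) ^ 2 ≤ s ^ 2 + (2 * A * B + B ^ 2) := by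
  nlinarith [mul_le_mul hs hbB hb0 (le_trans hs0 hs), mul_self_le_mul_self hb0 hbB]

/-- **Sect. D, upper half of (5) from (41)** (pp. 272–273 [18–19], (66)): if at step k the interaction terms are
≤ a|T₁^{(k)}| ((46) + Sect. D line 1), |E_k| ≤ b|T₁^{(k)}| ((65)), the remainder ≤ c|T₁^{(k)}| and the large-field sum
with the Z-terms is ≤ e^{d|T₁^{(k)}|} ((67)–(71) + [9]), then `ρ_k ≤ exp((a+b+c+d)|T₁^{(k)}|)`.  Re-derived
bookkeeping (monotonicity of the history functional and `LF(F + t) = eᵗLF(F)`); kernel-checked. [cite: Balaban1985UV3, (66) p.273] -/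
theorem upper5_of_41 (T : TowerRun) (k : ℕ) (a b c d : ℝ) (h41 : Ineq41 T k)
    (hP : ∀ (h : T.Hist k) (U : T.Cfg k), |T.Pint k h U| ≤ a * T.sites k)
    (hE : |T.Ecst k| ≤ b * T.sites k) (hR : T.Rm k ≤ c * T.sites k)
    (hLF : ∀ U : T.Cfg k, T.LF k U (fun h => -(T.mainT k h U) + T.Zterm k h) ≤ Real.exp (d * T.sites k))
    (U : T.Cfg k) : T.ρ k U ≤ Real.exp ((a + b + c + d) * T.sites k) := by
  have step1 := h41 U
  have step2 : T.LF k U (fun h => -(T.mainT k h U) + T.Pint k h U - T.Ecst k + T.Zterm k h + T.Rm k)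
      ≤ T.LF k U (fun h => (-(T.mainT k h U) + T.Zterm k h) + (a + b + c) * T.sites k) := by
    apply T.lf_mono; intro h
    have h1 := (abs_le.mp (hP h U)).2
    have h2 := (abs_le.mp hE).1
    nlinarith
  conv at step2 => rhs; rw [T.lf_shift]
  have step3 : Real.exp ((a + b + c) * T.sites k) * T.LF k U (fun h => -(T.mainT k h U) + T.Zterm k h)
      ≤ Real.exp ((a + b + c) * T.sites k) * Real.exp (d * T.sites k) :=
    mul_le_mul_of_nonneg_left (hLF U) (Real.exp_pos _).le
  rw [← Real.exp_add] at step3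
  calc T.ρ k U ≤ _ := step1
    _ ≤ _ := step2
    _ ≤ _ := step3
    _ = Real.exp ((a + b + c + d) * T.sites k) := by ring_nf

/-- **Sect. D, lower half of (5) from (47)** (p. 274 [20]: *"The lower bound is simpler, it is enough to use (44)–(46)
and (66) ⟦(65)⟧"*): `χ_k exp(−(1/g_k²)A^η(U_k(U)) − (a+b+c)|T₁^{(k)}|) ≤ ρ_k`.  Re-derived bookkeeping; note that NO
large-field input is needed on this side. [cite: Balaban1985UV3, Sect. D p.274] -/
theorem lower5_of_47 (T : TowerRun) (k : ℕ) (a b c : ℝ) (h47 : Ineq47 T k)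
    (hP : ∀ U : T.Cfg k, |T.Pint k (T.triv k) U| ≤ a * T.sites k)
    (hE : |T.Ecst k| ≤ b * T.sites k) (hR : T.Rm k ≤ c * T.sites k) (U : T.Cfg k) :
    T.χ k U * Real.exp (-((T.g k)⁻¹ ^ 2 * T.wilsonBG k U) - (a + b + c) * T.sites k) ≤ T.ρ k U := by
  refine le_trans ?_ (h47 U)
  apply mul_le_mul_of_nonneg_left _ (T.χ_nonneg k U)
  apply Real.exp_le_exp.mpr
  rw [T.mainT_triv]
  have h1 := (abs_le.mp (hP U)).1
  have h2 := (abs_le.mp hE).2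
  linarith

/-- Both halves: (41) ∧ (47) at step k with the four piece-bounds give `Bounds5At` with `O(1) = a + b + c + d`
(d ≥ 0).  Re-derived, kernel-checked. [cite: Balaban1985UV3, Sect. D pp.272–274] -/
theorem bounds5At_of_ineqs (T : TowerRun) (k : ℕ) (a b c d : ℝ) (hd : 0 ≤ d) (h41 : Ineq41 T k)
    (h47 : Ineq47 T k)
    (hP : ∀ (h : T.Hist k) (U : T.Cfg k), |T.Pint k h U| ≤ a * T.sites k)
    (hE : |T.Ecst k| ≤ b * T.sites k) (hR : T.Rm k ≤ c * T.sites k)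
    (hLF : ∀ U : T.Cfg k, T.LF k U (fun h => -(T.mainT k h U) + T.Zterm k h) ≤ Real.exp (d * T.sites k)) :
    Bounds5At T.toRunData (a + b + c + d) k := by
  intro U
  refine ⟨?_, upper5_of_41 T k a b c d h41 hP hE hR hLF U⟩
  have hlow := lower5_of_47 T k a b c h47 (fun U => hP (T.triv k) U) hE hR U
  refine le_trans ?_ hlow
  apply mul_le_mul_of_nonneg_left _ (T.χ_nonneg k U)
  apply Real.exp_le_exp.mpr
  have := mul_nonneg hd (T.sites_nonneg k)
  show -((T.g k)⁻¹ ^ 2 * T.wilsonBG k U) - (a + b + c + d) * T.sites k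
      ≤ -((T.g k)⁻¹ ^ 2 * T.wilsonBG k U) - (a + b + c) * T.sites k
  nlinarith

/-- **Theorem 1 (compact reading) from Theorem 2 and the Sect. D leaves**, for a family of runs: if the piece-bounds
hold with constants uniform in the run and the step — the E_k-constant being allowed to depend on the coupling WINDOW
[gmin, gmax] (it must: `Ecst_abs_le`) — then `Thm2Printed ⇒ Thm1PrintedCompact` with
`O(1) = a + b(gmin, gmax) + c + d`.  This is the typed content of the leaf `Thm1OfThm2Leaf` under the audit reading;
re-derived bookkeeping, kernel-checked. [cite: Balaban1985UV3, Sect. D pp.272–274] -/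
theorem thm1Compact_of_thm2 {I : Type} (T : I → TowerRun) (hspec : ∀ i, SpecOK (T i))
    (h2 : Thm2Printed (fun i => (T i).toRunData))
    (a c d : ℝ) (hd : 0 ≤ d) (b : ℝ → ℝ → ℝ)
    (hP : ∀ i k, k ≤ (T i).K → ∀ (h : (T i).Hist k) (U : (T i).Cfg k), |(T i).Pint k h U| ≤ a * (T i).sites k)
    (hE : ∀ gmin gmax : ℝ, ∀ i k, k ≤ (T i).K → gmin ≤ (T i).g k → (T i).g k ≤ gmax →
      |(T i).Ecst k| ≤ b gmin gmax * (T i).sites k)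
    (hR : ∀ i k, k ≤ (T i).K → (T i).Rm k ≤ c * (T i).sites k)
    (hLF : ∀ i k, k ≤ (T i).K → ∀ U : (T i).Cfg k,
      (T i).LF k U (fun h => -((T i).mainT k h U) + (T i).Zterm k h) ≤ Real.exp (d * (T i).sites k)) :
    Thm1PrintedCompact (fun i => (T i).toRunData) := by
  intro gmin gmax _ _
  refine ⟨a + b gmin gmax + c + d, fun i k hk hg1 hg2 => ?_⟩
  have h4147 := ((hspec i) k).mp (h2 i k hk)
  exact bounds5At_of_ineqs (T i) k a (b gmin gmax) c d hd h4147.1 h4147.2 (hP i k hk)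
    (hE gmin gmax i k hk hg1 hg2) (hR i k hk) (hLF i k hk)

end Tower

section Counterterms

/-- **(62)** p. 271 [17], verbatim: *"E^{(k)} = log σ₀|T₁^{(k)*}| + d(𝔤) log g_k |T₁^{(k)*}| + log Z^{(k)}(T₁^{(k)}, 1)
+ Σ_X 𝒫′_{k+1}(g_k, X, 1)"*, and p. 273 [19]: *"From (25), which holds for arbitrary j, we get easily |E^{(j)}| ≤
O(1)|T₁^{(j)}|"*.  What the triangle inequality actually gives, kernel-checked: with |T₁^{(k)*}| ≤ 3|T₁^{(k)}| (bonds of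
a 3-d torus), |log Z^{(k)}(T, 1)| ≤ z|T₁^{(k)}| (a g-INDEPENDENT unit-lattice Gaussian normalisation) and
|Σ_X 𝒫′(X, 1)| ≤ a|T₁^{(k)}| (from (25)), the bound is `(3|log σ₀| + z + a + 3 d(𝔤)|log g_k|)·|T₁^{(k)}|` — the
coefficient carries `d(𝔤)|log g_k|`, unbounded as g_k → 0 (cell GAPS G-B10-01: the printed "O(1)" of (65) is uniform
only for g_k in a compact subset of (0, ∞)). [cite: Balaban1985UV3, (62) p.271] -/
theorem Estep62_abs_le (logσ₀ dg logg logZ Pvac bonds sites a z : ℝ) (hdg : 0 ≤ dg)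
    (hb0 : 0 ≤ bonds) (hb : bonds ≤ 3 * sites)
    (hZ : |logZ| ≤ z * sites) (hP : |Pvac| ≤ a * sites) :
    |logσ₀ * bonds + dg * logg * bonds + logZ + Pvac| ≤ (3 * |logσ₀| + z + a + 3 * dg * |logg|) * sites := by
  have h1 : |logσ₀ * bonds| ≤ 3 * |logσ₀| * sites := by
    rw [abs_mul, abs_of_nonneg hb0]
    have := mul_le_mul_of_nonneg_left hb (abs_nonneg logσ₀)
    linarith
  have h2 : |dg * logg * bonds| ≤ 3 * dg * |logg| * sites := by
    rw [abs_mul, abs_mul, abs_of_nonneg hb0, abs_of_nonneg hdg]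
    have := mul_le_mul_of_nonneg_left hb (mul_nonneg hdg (abs_nonneg logg))
    linarith
  have h3 := abs_add_le (logσ₀ * bonds + dg * logg * bonds + logZ) Pvac
  have h4 := abs_add_le (logσ₀ * bonds + dg * logg * bonds) logZ
  have h5 := abs_add_le (logσ₀ * bonds) (dg * logg * bonds)
  linarith

/-- Elementary: `Σ_{m<n} (a + b m) rᵐ ≤ a/(1−r) + b r/(1−r)²` for 0 ≤ r < 1, a, b ≥ 0 (the two geometric series
behind (65) once the log term is explicit). [folklore] -/
theorem geomLin_sum_le (r a b : ℝ) (hr0 : 0 ≤ r) (hr1 : r < 1) (ha : 0 ≤ a) (hb : 0 ≤ b) (n : ℕ) :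
    ∑ m ∈ Finset.range n, (a + b * m) * r ^ m ≤ a / (1 - r) + b * (r / (1 - r) ^ 2) := by
  have hnorm : ‖r‖ < 1 := by rw [Real.norm_eq_abs, abs_of_nonneg hr0]; exact hr1
  have hgeo : ∑ m ∈ Finset.range n, r ^ m ≤ (1 - r)⁻¹ :=
    calc ∑ m ∈ Finset.range n, r ^ m ≤ ∑' m, r ^ m :=
          (summable_geometric_of_lt_one hr0 hr1).sum_le_tsum _ (fun i _ => pow_nonneg hr0 i)
      _ = (1 - r)⁻¹ := tsum_geometric_of_lt_one hr0 hr1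
  have hS := hasSum_coe_mul_geometric_of_norm_lt_one hnorm
  have hlin : ∑ m ∈ Finset.range n, (m : ℝ) * r ^ m ≤ r / (1 - r) ^ 2 :=
    calc ∑ m ∈ Finset.range n, (m : ℝ) * r ^ m ≤ ∑' m : ℕ, (m : ℝ) * r ^ m :=
          hS.summable.sum_le_tsum _ (fun i _ => mul_nonneg (Nat.cast_nonneg i) (pow_nonneg hr0 i))
      _ = r / (1 - r) ^ 2 := hS.tsum_eq
  have hsplit : ∑ m ∈ Finset.range n, (a + b * m) * r ^ m
      = a * ∑ m ∈ Finset.range n, r ^ m + b * ∑ m ∈ Finset.range n, (m : ℝ) * r ^ m := by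
    rw [Finset.mul_sum, Finset.mul_sum, ← Finset.sum_add_distrib]
    apply Finset.sum_congr rfl; intro m _; ring
  rw [hsplit, div_eq_mul_inv a]
  exact add_le_add (mul_le_mul_of_nonneg_left hgeo ha) (mul_le_mul_of_nonneg_left hlin hb)

/-- **(64)** p. 273 [19], verbatim: *"E_k = Σ_{j=k}^{K−1} E^{(j)}, where E^{(j)} is defined by (62)"* — with p. 271 [17]
*"The constant E_{k+1} is defined as E_{k+1} = E_k − E^{(k)}"*, p. 265 [11] *"E₁ = E − E^{(0)}"* and E₀ = E this is the
inductive definition of the vacuum-energy counterterm announced on p. 256 (*"we prefer to give an inductive definition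
during the proof"*).  As a function of the step profile `E^{(·)}`. [cite: Balaban1985UV3, (64) p.273] -/
def Ek (E : ℕ → ℝ) (K k : ℕ) : ℝ := ∑ j ∈ Finset.Ico k K, E j

/-- E₀ = E = Σ_{j<K} E^{(j)} (p. 256: "a properly defined function E of ε, g₀ and the number of sites").
Elementary. [folklore] -/
theorem Ek_zero (E : ℕ → ℝ) (K : ℕ) : Ek E K 0 = ∑ j ∈ Finset.range K, E j := by
  simp [Ek, Nat.Ico_zero_eq_range]

/-- p. 271 [17]: `E_{k+1} = E_k − E^{(k)}` (k < K).  Elementary telescoping. [folklore] -/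
theorem Ek_succ (E : ℕ → ℝ) {K k : ℕ} (hk : k < K) : Ek E K (k + 1) = Ek E K k - E k := by
  unfold Ek
  rw [Finset.sum_eq_sum_Ico_succ_bot hk]
  ring

/-- `E_K = 0`: after the last step no counterterm is left (consistent with (6)).  Elementary. [folklore] -/
theorem Ek_top (E : ℕ → ℝ) (K : ℕ) : Ek E K K = 0 := by simp [Ek]

/-- **(65)** p. 273 [19], verbatim: *"|E_k| ≤ Σ_{k=k}^{K−1} ⟦j = k⟧ O(1)|T₁^{(j)}| = Σ_{j=k}^{K−1} O(1)L^{−3(j−k)}|T₁^{(k)}|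
≤ O(1)|T₁^{(k)}|"* — re-derived WITH THE LOG TERM: if `|E^{(j)}| ≤ (a + b c_j)s_j` with `s_{k+m} = rᵐ s_k` (r = L⁻³)
and `c_{k+m} ≤ c_k + ℓm` (c_j = |log g_j|, ℓ = ½log L by `abs_log_gRun_shift_le`), then
`|E_k| ≤ ((a + b c_k)/(1−r) + bℓ r/(1−r)²) s_k` — O(1)|T₁^{(k)}| with O(1) affine in |log g_k|.  Kernel-checked. [cite: Balaban1985UV3, (65) p.273] -/
theorem Ek_abs_le (E s c : ℕ → ℝ) (K k : ℕ) (r a b ℓ : ℝ) (hr0 : 0 ≤ r) (hr1 : r < 1)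
    (ha : 0 ≤ a) (hb : 0 ≤ b) (hℓ : 0 ≤ ℓ) (hsk : 0 ≤ s k) (hck : 0 ≤ c k)
    (hs : ∀ m, s (k + m) = r ^ m * s k)
    (hc : ∀ m, c (k + m) ≤ c k + ℓ * m)
    (hE : ∀ j, k ≤ j → j < K → |E j| ≤ (a + b * c j) * s j) :
    |Ek E K k| ≤ ((a + b * c k) / (1 - r) + (b * ℓ) * (r / (1 - r) ^ 2)) * s k := by
  unfold Ek
  have step1 : |∑ j ∈ Finset.Ico k K, E j| ≤ ∑ j ∈ Finset.Ico k K, |E j| :=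
    Finset.abs_sum_le_sum_abs _ _
  have step2 : ∑ j ∈ Finset.Ico k K, |E j| ≤ ∑ j ∈ Finset.Ico k K, (a + b * c j) * s j := by
    apply Finset.sum_le_sum; intro j hj
    rw [Finset.mem_Ico] at hj
    exact hE j hj.1 hj.2
  have step3 : ∑ j ∈ Finset.Ico k K, (a + b * c j) * s j
      = ∑ m ∈ Finset.range (K - k), (a + b * c (k + m)) * s (k + m) := by
    rw [Finset.sum_Ico_eq_sum_range]
  have step4 : ∑ m ∈ Finset.range (K - k), (a + b * c (k + m)) * s (k + m)
      ≤ ∑ m ∈ Finset.range (K - k), (((a + b * c k) + (b * ℓ) * m) * r ^ m) * s k := by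
    apply Finset.sum_le_sum; intro m _
    rw [hs m]
    have hcm : c (k + m) ≤ c k + ℓ * m := hc m
    have hrm : 0 ≤ r ^ m := pow_nonneg hr0 m
    have : a + b * c (k + m) ≤ (a + b * c k) + (b * ℓ) * m := by nlinarith
    calc (a + b * c (k + m)) * (r ^ m * s k) = ((a + b * c (k + m)) * r ^ m) * s k := by ring
      _ ≤ (((a + b * c k) + (b * ℓ) * m) * r ^ m) * s k :=
          mul_le_mul_of_nonneg_right (mul_le_mul_of_nonneg_right this hrm) hsk
  have step5 : ∑ m ∈ Finset.range (K - k), (((a + b * c k) + (b * ℓ) * m) * r ^ m) * s k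
      ≤ ((a + b * c k) / (1 - r) + (b * ℓ) * (r / (1 - r) ^ 2)) * s k := by
    rw [← Finset.sum_mul]
    apply mul_le_mul_of_nonneg_right _ hsk
    exact geomLin_sum_le r _ _ hr0 hr1 (by positivity) (by positivity) _
  linarith [step1, step2, step3, step4, step5]

/-- (64)–(65) ON THE CARRIER with the model scaling (3): for a run with `g_k = g(L^kε)^{1/2}`, `|T₁^{(k)}| =
(L^kε)^{−3}|T_ε|` and the per-step bound `|E^{(j)}| ≤ (a₁ + d(𝔤)|log g_j|)|T₁^{(j)}|` of `Estep62_abs_le`,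
`|E_k| ≤ ((a₁ + d(𝔤)|log g_k|)/(1 − L⁻³) + d(𝔤)(½log L) L⁻³/(1 − L⁻³)²)·|T₁^{(k)}|`.  Kernel-checked. [cite: Balaban1985UV3, (64)–(65) p.273] -/
theorem Ecst_abs_le (T : TowerRun) (gb L ε Tε a₁ dg : ℝ) (hg : 0 < gb) (hL : 1 < L) (hε : 0 < ε)
    (hT : 0 ≤ Tε) (ha : 0 ≤ a₁) (hdg : 0 ≤ dg)
    (hgk : ∀ k, T.g k = gRun gb L ε k) (hsk : ∀ k, T.sites k = sitesRun L ε Tε k)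
    (hstep : ∀ j, j < T.K → |T.Estep j| ≤ (a₁ + dg * |Real.log (T.g j)|) * T.sites j) (k : ℕ) :
    |T.Ecst k| ≤ ((a₁ + dg * |Real.log (T.g k)|) / (1 - (L ^ 3)⁻¹)
      + (dg * (Real.log L / 2)) * ((L ^ 3)⁻¹ / (1 - (L ^ 3)⁻¹) ^ 2)) * T.sites k := by
  rw [T.Ecst_eq k]
  have hL0 : 0 < L := by linarith
  have hr0 : 0 ≤ (L ^ 3)⁻¹ := by positivity
  have hr1 : (L ^ 3)⁻¹ < 1 := inv_lt_one_of_one_lt₀ (one_lt_pow₀ hL (by norm_num))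
  have hsk0 : 0 ≤ T.sites k := by rw [hsk]; unfold sitesRun; positivity
  have := Ek_abs_le T.Estep T.sites (fun j => |Real.log (T.g j)|) T.K k (L ^ 3)⁻¹ a₁ dg (Real.log L / 2)
    hr0 hr1 ha hdg (by have := Real.log_nonneg hL.le; linarith) hsk0 (abs_nonneg _)
    (fun m => by rw [hsk, hsk, sitesRun_shift])
    (fun m => by simp only [hgk]; exact abs_log_gRun_shift_le gb L ε hg hL.le hε k m)
    (fun j _ hj => hstep j hj)
  simpa [Ek] using this

/-- Elementary: on a compact window, `|log x| ≤ max(|log gmin|, |log gmax|)` for gmin ≤ x ≤ gmax, 0 < gmin — the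
step from `Ecst_abs_le` to a WINDOW-dependent constant b(gmin, gmax) in `thm1Compact_of_thm2`. [folklore] -/
theorem abs_log_le_of_mem (gmin gmax x : ℝ) (hmin : 0 < gmin) (h1 : gmin ≤ x) (h2 : x ≤ gmax) :
    |Real.log x| ≤ max |Real.log gmin| |Real.log gmax| := by
  have hx : 0 < x := lt_of_lt_of_le hmin h1
  have l1 : Real.log gmin ≤ Real.log x := Real.log_le_log hmin h1
  have l2 : Real.log x ≤ Real.log gmax := Real.log_le_log hx h2
  rw [abs_le]; constructor
  · have : -max |Real.log gmin| |Real.log gmax| ≤ -|Real.log gmin| := by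
      linarith [le_max_left |Real.log gmin| |Real.log gmax|]
    linarith [neg_abs_le (Real.log gmin)]
  · linarith [le_abs_self (Real.log gmax), le_max_right |Real.log gmin| |Real.log gmax|]

/-- The window-dependent E_k constant: under the hypotheses of `Ecst_abs_le`, for `g_k ∈ [gmin, gmax] ⊂ (0, ∞)`,
`|E_k| ≤ b(gmin, gmax)|T₁^{(k)}|` with `b = (a₁ + d(𝔤)M)/(1 − L⁻³) + d(𝔤)(½log L)L⁻³/(1 − L⁻³)²`,
M = max(|log gmin|, |log gmax|).  Kernel-checked. [cite: Balaban1985UV3, (65) p.273] -/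
theorem Ecst_abs_le_window (T : TowerRun) (gb L ε Tε a₁ dg : ℝ) (hg : 0 < gb) (hL : 1 < L) (hε : 0 < ε)
    (hT : 0 ≤ Tε) (ha : 0 ≤ a₁) (hdg : 0 ≤ dg)
    (hgk : ∀ k, T.g k = gRun gb L ε k) (hsk : ∀ k, T.sites k = sitesRun L ε Tε k)
    (hstep : ∀ j, j < T.K → |T.Estep j| ≤ (a₁ + dg * |Real.log (T.g j)|) * T.sites j)
    (gmin gmax : ℝ) (hmin : 0 < gmin) (k : ℕ) (h1 : gmin ≤ T.g k) (h2 : T.g k ≤ gmax) :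
    |T.Ecst k| ≤ ((a₁ + dg * max |Real.log gmin| |Real.log gmax|) / (1 - (L ^ 3)⁻¹)
      + (dg * (Real.log L / 2)) * ((L ^ 3)⁻¹ / (1 - (L ^ 3)⁻¹) ^ 2)) * T.sites k := by
  have hmain := Ecst_abs_le T gb L ε Tε a₁ dg hg hL hε hT ha hdg hgk hsk hstep k
  have hM := abs_log_le_of_mem gmin gmax (T.g k) hmin h1 h2
  have hL0 : 0 < L := by linarith
  have hr1 : (L ^ 3)⁻¹ < 1 := inv_lt_one_of_one_lt₀ (one_lt_pow₀ hL (by norm_num))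
  have h1r : 0 < 1 - (L ^ 3)⁻¹ := by linarith
  have hsk0 : 0 ≤ T.sites k := by rw [hsk]; unfold sitesRun; positivity
  refine le_trans hmain (mul_le_mul_of_nonneg_right ?_ hsk0)
  have : (a₁ + dg * |Real.log (T.g k)|) / (1 - (L ^ 3)⁻¹)
      ≤ (a₁ + dg * max |Real.log gmin| |Real.log gmax|) / (1 - (L ^ 3)⁻¹) :=
    div_le_div_of_nonneg_right (by nlinarith) h1r.le
  linarith

/-- Elementary backward geometric sum: if `x_j = q x_{j+1}` (0 ≤ q < 1, x ≥ 0) then `Σ_{j<k} x_j ≤ x_k q/(1−q)`. [folklore] -/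
theorem geomBack_sum_le (x : ℕ → ℝ) (q : ℝ) (hq0 : 0 ≤ q) (hq1 : q < 1) (hx0 : ∀ j, 0 ≤ x j)
    (hx : ∀ j, x j = q * x (j + 1)) (k : ℕ) :
    ∑ j ∈ Finset.range k, x j ≤ x k * (q / (1 - q)) := by
  induction k with
  | zero => simp; exact mul_nonneg (hx0 0) (div_nonneg hq0 (by linarith))
  | succ k ih =>
    rw [Finset.sum_range_succ]
    have h1q : 0 < 1 - q := by linarith
    have : x k * (q / (1 - q)) + x k = x (k + 1) * (q / (1 - q)) := by
      rw [hx k]; field_simp; ring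
    linarith

/-- The remainder term of (41)/(47), `Σ_{j=0}^{k−1} O((L^jε)^{3+κ₀})|T₁^{(j)}|` (pp. 266–267 [12–13]), is O(1)|T₁^{(k)}|
uniformly: since `|T₁^{(j)}| = (L^jε)^{−3}|T_ε|` each summand is `C(L^jε)^{κ₀}|T_ε|` and
`Σ_{j<k} (L^jε)^{κ₀} ≤ (L^kε)^{κ₀} L^{−κ₀}/(1 − L^{−κ₀})` (then `(L^kε)^{κ₀}|T_ε| = (L^kε)^{3+κ₀}|T₁^{(k)}| ≤
ε₀^{3+κ₀}|T₁^{(k)}|`).  Re-derived, kernel-checked (real exponent κ₀ > 0). [cite: Balaban1985UV3, (41) p.266] -/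
theorem remainderSum_le (L ε κ : ℝ) (hL : 1 < L) (hε : 0 < ε) (hκ : 0 < κ) (k : ℕ) :
    ∑ j ∈ Finset.range k, (L ^ j * ε) ^ κ ≤ (L ^ k * ε) ^ κ * ((L ^ κ)⁻¹ / (1 - (L ^ κ)⁻¹)) := by
  have hLκ : 1 < L ^ κ := Real.one_lt_rpow hL hκ
  have hq0 : 0 ≤ (L ^ κ)⁻¹ := by positivity
  have hq1 : (L ^ κ)⁻¹ < 1 := inv_lt_one_of_one_lt₀ hLκ
  have hL0 : 0 < L := by linarith
  apply geomBack_sum_le (fun j => (L ^ j * ε) ^ κ) _ hq0 hq1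
  · intro j; positivity
  · intro j
    show (L ^ j * ε) ^ κ = (L ^ κ)⁻¹ * (L ^ (j + 1) * ε) ^ κ
    rw [pow_succ, show L ^ j * L * ε = L * (L ^ j * ε) by ring,
      Real.mul_rpow hL0.le (by positivity)]
    field_simp

end Counterterms

section Edges

/-- EDGE to [4] = [Balaban1985Averaging] (cell record `…Balaban1983to89.B7`), p. 258 [4], verbatim: *"If a configuration
U belongs to this region, then it satisfies the regularity conditions |U(∂p) − 1| < g₀p(g₀) on the domain Ω₀, and by
Proposition 1 from [4] the configuration V = Ū satisfies the conditions |V(∂p′) − 1| < 2L²g₀p(g₀) on Ω₀^{(1)}."*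
(the same factor 2L² in (40) p. 266 and in p. 267 line 2: *"This implies the condition |Ū_k^j(∂p′) − 1| <
4L²B₃g_{k−1}p(g_{k−1})(L^jη)²"*).  What the typed Prop. 1 of B7 (`avgDev < L²α₀ + C₀(L²α₀)²` for α₀ ≤ c′₂) gives:
for `α₀ ≤ min(c′₂, (C₀L²)⁻¹)` the conclusion `< 2L²α₀` — the factor 2 is honest for α₀ = g₀p(g₀) small.
Kernel-checked composition. [cite: Balaban1985UV3, p.258] -/
theorem edge_B7Prop1_twoLsq {I : Type} (L : ℝ) (hL : 0 < L) (fam : I → B7.OneStep)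
    (h : B7.Prop1Printed L fam) :
    ∃ c : ℝ, 0 < c ∧ ∀ i : I, ∀ α₀ : ℝ, 0 < α₀ → α₀ ≤ c → ∀ V : (fam i).Cfg,
      (fam i).plaqDev V < α₀ → (fam i).avgDev V < 2 * L ^ 2 * α₀ := by
  obtain ⟨C₀, c₂', hC₀, hc₂', hP⟩ := h
  have hCL : 0 < C₀ * L ^ 2 := by positivity
  refine ⟨min c₂' (C₀ * L ^ 2)⁻¹, lt_min hc₂' (inv_pos.mpr hCL), ?_⟩
  intro i α₀ hα hαc V hV
  have h1 := hP i α₀ hα (le_trans hαc (min_le_left _ _)) V hV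
  have h2 : α₀ ≤ (C₀ * L ^ 2)⁻¹ := le_trans hαc (min_le_right _ _)
  have h3 : C₀ * L ^ 2 * α₀ ≤ 1 := by
    have := mul_le_mul_of_nonneg_left h2 hCL.le
    rwa [mul_inv_cancel₀ hCL.ne'] at this
  have h4 : C₀ * (L ^ 2 * α₀) ^ 2 ≤ L ^ 2 * α₀ := by
    have hLa : 0 ≤ L ^ 2 * α₀ := by positivity
    nlinarith
  linarith

/-- EDGE to [6] = [Balaban1985RegularSpaces] (cell record `…Balaban1983to89.B8`), p. 259 [5], verbatim: *"The
configuration U₁ satisfies the regularity conditions |U₁(∂p) − 1| < 2B₃g₀p(g₀) on Ω₁, hence U₁, U′U₁ satisfy the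
assumptions of Lemma 1 [6] with α₀ = 2L²B₃g₀p(g₀), α₁ = 0, and the lemma yields the bound |V′ − 1| <
8·3²L²B₃g₀p(g₀) for g₀ sufficiently small."*, and p. 268 [14]: *"The restrictions on V_k and V_k^{(k)} imply that the
configuration V′_k − 1 is small, more exactly |V′_k − 1| < 16·3²L²B₃g_kp(g_k)."* — i.e. Lemma 1 of [6]
(`|V′ − 1| < 4d²α₀ + α₁`, (1.25) there) with d = 3 and, as printed, α₁ = 0 (4·3²·2L²B₃g₀p(g₀) = 8·3²L²B₃g₀p(g₀)).
The cell's typing of that lemma (`B8.Lemma1Printed`, verbatim "for α₀, α₁ small") quantifies `0 < α₁`; the printed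
α₁ = 0 use follows by letting α₁ ↓ 0, with `≤` in place of `<` (cell DIVERGENCE D-b10.4; harmless).  Kernel-checked
composition. [cite: Balaban1985UV3, pp.259 + 268] -/
theorem edge_B8Lemma1_alpha1_zero {I : Type} (fam : I → B8.LocalData) (h : B8.Lemma1Printed 3 fam) :
    ∃ c : ℝ, 0 < c ∧ ∀ i : I, ∀ α₀ : ℝ, 0 < α₀ → α₀ ≤ c →
      ∀ V₀ : (fam i).Cfg, ∀ V' : (fam i).Pert, (fam i).small α₀ V₀ V' →
        (∀ α₁ : ℝ, 0 < α₁ → (fam i).axialClose α₁ V₀ V') → (fam i).pertDev V' ≤ 4 * 3 ^ 2 * α₀ := by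
  obtain ⟨c, hc, hL⟩ := h
  refine ⟨c, hc, fun i α₀ hα hαc V₀ V' hs hax => ?_⟩
  apply le_of_forall_pos_lt_add
  intro e he
  have hm : 0 < min e c := lt_min he hc
  have := hL i α₀ (min e c) hα hαc hm (min_le_right _ _) V₀ V' hs (hax (min e c) hm)
  calc (fam i).pertDev V' < 4 * (3:ℕ) ^ 2 * α₀ + min e c := this
    _ ≤ 4 * 3 ^ 2 * α₀ + e := by push_cast; linarith [min_le_left e c]

end Edges

end Literature.MathematicalPhysics.QuantumFieldTheory.Balaban1983to89.B10
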